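import Literature.Topology.FourManifolds.BraidedTorusSheet
import Literature.Topology.FourManifolds.PlumbingCoordinatesOfArcs
import Literature.Topology.FourManifolds.QuarterCoordSeparation
import HarnessLib

/-!
# Plumbing coordinates of the braided second sheet of `Σ̄₂`

Topic `Literature/Topology/FourManifolds` (fact seat of the Seiberg–Witten leaf
`Literature.Barriers.SmoothPoincare4.akhmedovPark2010_lemma8_invariants`; block 2 of
Akhmedov–Park's `X₁(m)`, Invent. Math. 181 (2010), §3).  For the braided torus tube
`T₂ (w, v) = e⁻¹ (G (w, v))`, `G (w, v) = ((into (θ σ · A v), σ²), τ)` of `BraidedTorusSheet.lean`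
with base point `x₀ = (ϑ⁻¹, 1)`, `ϑ = e^{i r₀}` (so that the flat values of the loop are
`x₂ = (1, 1)` and `x₃ = (ϑ⁻², 1)`), and the plumbing charts `P₂`, `P₃` of `X = T⁴` built on the
scaled quarter charts `eQ₂` at `x₂`, `eQ₃` at `x₃` (`SurfaceTimesTorusPlumbingChart.lean`,
`TorusQuarterChart.lean`), we record:

* `coords_of_re_ge` / `coords_of_re_le` — on the flat spots `Re σ ≥ 3/4` resp. `Re σ ≤ -3/4`,
  `T₂ (w, v) ∈ P.source ↔ (0 < Re σ² ∧ 0 < Re τ)` and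
  `toC2 (P (T₂ (w, v))) = (c′ r(v), c (Im σ²/Re σ², Im τ/Re τ))` for `P = P₂` resp. `P₃`
  (`r` the thin-arc coordinate);
* `snd_coord` — for ANY `w`, the second plumbing coordinate of a point `T₂ (w, v) ∈ P.source` is
  `c (Im σ²/Re σ², Im τ/Re τ)`, with `Re σ² > 0`, `Re τ > 0`;
* `one_le_norm_of_re_ge` / `one_le_norm_of_re_le` — a flat-spot tube point over `Re σ ≥ 3/4`
  lying in `P₃.source` has `‖P₃ ·‖ ≥ 1` (its first quarter coordinate at `x₃` is at least
  `c′ tan (2 (2 r₀ - δ π/4))`), and symmetrically: the two plumbing balls see only their own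
  flat spot;
* `flat_of_norm_lt` — `‖c (Im σ²/Re σ², Im τ/Re τ)‖ < 1`, `Re σ² > 0`, `c ≥ 3` force
  `|Re σ| > 3/4`.

Everything is proved; no definitions (all maps bound by hypotheses).

## References

* A. Akhmedov, B. D. Park, Invent. Math. 181 (2010) 577–603 = arXiv:math/0701829, §3. [AkhmedovPark2010]
-/

noncomputable section

open scoped Manifold ContDiff Topology Real
open Set Function Complex
open Literature.Geometry.Manifold (Rechart)
open Literature.Topology.FourManifolds.ToricBlowup

namespace Literature.Topology.FourManifolds

namespace BraidedSheetCoords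

/-! ### §0 Circle and norm bookkeeping -/

/-- `(e^{i r})⁻¹ · e^{-i r} = ((e^{i r})⁻¹)²` and `(e^{i r})⁻¹ · e^{i r} = 1` in the circle group.
[folklore] -/
theorem circleExp_inv_facts (r : ℝ) :
    (Circle.exp r)⁻¹ * Circle.exp r = 1 ∧ (Circle.exp r)⁻¹ * Circle.exp (-r) = (Circle.exp r)⁻¹ ^ 2 ∧
      (((Circle.exp r)⁻¹ ^ 2 : Circle)) * Circle.exp (2 * r) = 1 := by
  refine ⟨inv_mul_cancel _, ?_, ?_⟩
  · rw [sq, Circle.exp_neg]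
  · have h2r : Circle.exp (2 * r) = Circle.exp r ^ 2 := by rw [sq, ← Circle.exp_add, two_mul]
    rw [inv_pow, h2r, inv_mul_cancel]

/-- A coordinate is bounded by the Euclidean norm: `|w 0| ≤ ‖w‖` in `ℝ⁴`. [folklore] -/
theorem abs_apply_zero_le_norm (w : EuclideanSpace ℝ (Fin 4)) : |w 0| ≤ ‖w‖ := by
  have h : w 0 ^ 2 ≤ ‖w‖ ^ 2 := by
    rw [EuclideanSpace.norm_eq, Real.sq_sqrt (Finset.sum_nonneg fun i _ => by positivity)]
    have := Finset.single_le_sum (f := fun i : Fin 4 => ‖w i‖ ^ 2) (fun i _ => by positivity)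
      (Finset.mem_univ (0 : Fin 4))
    simpa [Real.norm_eq_abs, sq_abs] using this
  exact abs_le_of_sq_le_sq' h (norm_nonneg _) |>.elim (fun h1 h2 => abs_le.2 ⟨h1, h2⟩)

/-- **Flatness from the second plumbing coordinate**: if `Re σ² > 0` and
`|c · Im σ²/Re σ²| < 1` with `c ≥ 3`, then `|Re σ| > 3/4`. [folklore] -/
theorem flat_of_quarter_lt {σ : Circle} {c : ℝ} (hc : 3 ≤ c) (hre : 0 < (((σ : ℂ)) ^ 2).re)
    (h : |c * ((((σ : ℂ)) ^ 2).im / (((σ : ℂ)) ^ 2).re)| < 1) : 3 / 4 < |(σ : ℂ).re| := by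
  apply BraidedTorus.abs_re_gt_of_re_sq_gt
  have hn : (((σ : ℂ)) ^ 2).re ^ 2 + (((σ : ℂ)) ^ 2).im ^ 2 = 1 := by
    have h1 : ‖((σ : ℂ)) ^ 2‖ ^ 2 = 1 := by rw [norm_pow, Circle.norm_coe, one_pow, one_pow]
    rw [Complex.sq_norm, Complex.normSq_apply] at h1
    nlinarith [h1]
  rw [abs_mul, abs_of_pos (by linarith), abs_div, abs_of_pos hre] at h
  have hq : |(((σ : ℂ)) ^ 2).im| / (((σ : ℂ)) ^ 2).re < 1 / 3 := by
    have h3 : c * (|(((σ : ℂ)) ^ 2).im| / (((σ : ℂ)) ^ 2).re) < 1 := h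
    have hpos : 0 ≤ |(((σ : ℂ)) ^ 2).im| / (((σ : ℂ)) ^ 2).re := by positivity
    nlinarith
  rw [div_lt_iff₀ hre] at hq
  have habs : (((σ : ℂ)) ^ 2).im ^ 2 = |(((σ : ℂ)) ^ 2).im| ^ 2 := (sq_abs _).symm
  nlinarith [abs_nonneg ((((σ : ℂ)) ^ 2).im)]

/-! ### §1 The data -/

section Data

variable {f : ModelProd (EuclideanSpace ℝ (Fin 1)) (EuclideanSpace ℝ (Fin 1)) ≃ₜ EuclideanSpace ℝ (Fin 2)}
  {X : Type*} [TopologicalSpace X]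
  {e : X ≃ₜ (Rechart f (Circle × Circle) × Circle) × Circle}
  {x₀ : Circle × Circle} {r₀ δ c c' : ℝ}
  {κ : Circle → ℂ} {θ : Circle → Circle × Circle} {A : EuclideanSpace ℝ (Fin 2) → Circle × Circle}
  {G : Rechart f (Circle × Circle) × EuclideanSpace ℝ (Fin 2) → (Rechart f (Circle × Circle) × Circle) × Circle}
  {T₂ : Rechart f (Circle × Circle) × EuclideanSpace ℝ (Fin 2) → X}
  {eQ₂ eQ₃ : OpenPartialHomeomorph (Rechart f (Circle × Circle)) (EuclideanSpace ℝ (Fin 2))}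
  {P₂ P₃ : OpenPartialHomeomorph X (EuclideanSpace ℝ (Fin 4))}
  {rc : EuclideanSpace ℝ (Fin 2) → ℂ} {bf : Rechart f (Circle × Circle) → ℂ}

variable (hκ : ∀ σ : Circle, κ σ = ((‖((σ : ℂ).re : ℂ) + (((σ : ℂ).im *
      (Real.smoothTransition (3 - 4 * (σ : ℂ).re) * Real.smoothTransition (3 + 4 * (σ : ℂ).re)) : ℝ) : ℂ) * I‖⁻¹ : ℝ) : ℂ) *
    (((σ : ℂ).re : ℂ) + (((σ : ℂ).im *
      (Real.smoothTransition (3 - 4 * (σ : ℂ).re) * Real.smoothTransition (3 + 4 * (σ : ℂ).re)) : ℝ) : ℂ) * I))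
  (hθ : ∀ σ : Circle, θ σ = (x₀.1 * Circle.exp (r₀ * (κ σ).re), x₀.2 * Circle.exp (r₀ * (κ σ).im)))
  (hA : ∀ v : EuclideanSpace ℝ (Fin 2),
    A v = (Circle.exp (δ * Real.arctan (v 0) / 2), Circle.exp (δ * Real.arctan (v 1) / 2)))
  (hG : ∀ (w : Rechart f (Circle × Circle)) (v : EuclideanSpace ℝ (Fin 2)),
    G (w, v) = ((Rechart.into f (Circle × Circle) (θ (Rechart.out f (Circle × Circle) w).1 * A v),
      (Rechart.out f (Circle × Circle) w).1 ^ 2), (Rechart.out f (Circle × Circle) w).2))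
  (hx₀ : x₀ = ((Circle.exp r₀)⁻¹, 1))
  (hT₂ : ∀ q, T₂ q = e.symm (G q))
  (hδ : 0 ≤ δ) (hδ1 : δ ≤ 1)
  (heQ₂s : eQ₂.source = {x | (0 < ((((Rechart.out f (Circle × Circle) x).1 * (1 : Circle)⁻¹ : Circle) : ℂ)).re ∧
        0 < ((((Rechart.out f (Circle × Circle) x).1 * (1 : Circle)⁻¹ : Circle) : ℂ) ^ 2).re) ∧
      (0 < ((((Rechart.out f (Circle × Circle) x).2 * (1 : Circle)⁻¹ : Circle) : ℂ)).re ∧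
        0 < ((((Rechart.out f (Circle × Circle) x).2 * (1 : Circle)⁻¹ : Circle) : ℂ) ^ 2).re)})
  (heQ₂v : ∀ x, eQ₂ x 0 = c' * ((((((Rechart.out f (Circle × Circle) x).1 * (1 : Circle)⁻¹ : Circle) : ℂ) ^ 2).im /
        ((((Rechart.out f (Circle × Circle) x).1 * (1 : Circle)⁻¹ : Circle) : ℂ) ^ 2).re)) ∧
      eQ₂ x 1 = c' * ((((((Rechart.out f (Circle × Circle) x).2 * (1 : Circle)⁻¹ : Circle) : ℂ) ^ 2).im /
        ((((Rechart.out f (Circle × Circle) x).2 * (1 : Circle)⁻¹ : Circle) : ℂ) ^ 2).re)))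
  (heQ₃s : eQ₃.source = {x | (0 < ((((Rechart.out f (Circle × Circle) x).1 * ((Circle.exp r₀)⁻¹ ^ 2 : Circle)⁻¹ : Circle) : ℂ)).re ∧
        0 < ((((Rechart.out f (Circle × Circle) x).1 * ((Circle.exp r₀)⁻¹ ^ 2 : Circle)⁻¹ : Circle) : ℂ) ^ 2).re) ∧
      (0 < ((((Rechart.out f (Circle × Circle) x).2 * (1 : Circle)⁻¹ : Circle) : ℂ)).re ∧
        0 < ((((Rechart.out f (Circle × Circle) x).2 * (1 : Circle)⁻¹ : Circle) : ℂ) ^ 2).re)})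
  (heQ₃v : ∀ x, eQ₃ x 0 = c' * ((((((Rechart.out f (Circle × Circle) x).1 * ((Circle.exp r₀)⁻¹ ^ 2 : Circle)⁻¹ : Circle) : ℂ) ^ 2).im /
        ((((Rechart.out f (Circle × Circle) x).1 * ((Circle.exp r₀)⁻¹ ^ 2 : Circle)⁻¹ : Circle) : ℂ) ^ 2).re)) ∧
      eQ₃ x 1 = c' * ((((((Rechart.out f (Circle × Circle) x).2 * (1 : Circle)⁻¹ : Circle) : ℂ) ^ 2).im /
        ((((Rechart.out f (Circle × Circle) x).2 * (1 : Circle)⁻¹ : Circle) : ℂ) ^ 2).re)))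
  (hP₂s : P₂.source = {x | (e x).1.1 ∈ eQ₂.source ∧ 0 < (((e x).1.2 : Circle) : ℂ).re ∧
      0 < (((e x).2 : Circle) : ℂ).re})
  (hP₂v : ∀ x, toC2 (P₂ x) = ((⟨eQ₂ (e x).1.1 0, eQ₂ (e x).1.1 1⟩ : ℂ),
      (⟨c * ((((e x).1.2 : Circle) : ℂ).im / (((e x).1.2 : Circle) : ℂ).re),
        c * ((((e x).2 : Circle) : ℂ).im / (((e x).2 : Circle) : ℂ).re)⟩ : ℂ)))
  (hP₃s : P₃.source = {x | (e x).1.1 ∈ eQ₃.source ∧ 0 < (((e x).1.2 : Circle) : ℂ).re ∧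
      0 < (((e x).2 : Circle) : ℂ).re})
  (hP₃v : ∀ x, toC2 (P₃ x) = ((⟨eQ₃ (e x).1.1 0, eQ₃ (e x).1.1 1⟩ : ℂ),
      (⟨c * ((((e x).1.2 : Circle) : ℂ).im / (((e x).1.2 : Circle) : ℂ).re),
        c * ((((e x).2 : Circle) : ℂ).im / (((e x).2 : Circle) : ℂ).re)⟩ : ℂ)))
  (hrc : ∀ u, rc u = ⟨Real.tan (δ * Real.arctan (u 0)), Real.tan (δ * Real.arctan (u 1))⟩)
  (hbf : ∀ w, bf w = ⟨c * (((((Rechart.out f (Circle × Circle) w).1 : Circle) : ℂ) ^ 2).im /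
      ((((Rechart.out f (Circle × Circle) w).1 : Circle) : ℂ) ^ 2).re),
    c * ((((Rechart.out f (Circle × Circle) w).2 : Circle) : ℂ).im /
      (((Rechart.out f (Circle × Circle) w).2 : Circle) : ℂ).re)⟩)

include hκ hθ hG hx₀ hT₂ in
/-- **The two flat forms of the braided tube**, with `x₀ = (ϑ⁻¹, 1)`:
`e (T₂ (w, v)) = ((into ((1, 1) · A v), σ²), τ)` for `Re σ ≥ 3/4` and
`= ((into ((ϑ⁻², 1) · A v), σ²), τ)` for `Re σ ≤ -3/4`. [cite: AkhmedovPark2010, §3] -/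
theorem flat_forms (w : Rechart f (Circle × Circle)) (v : EuclideanSpace ℝ (Fin 2)) :
    (3 / 4 ≤ (((Rechart.out f (Circle × Circle) w).1 : Circle) : ℂ).re →
      e (T₂ (w, v)) = ((Rechart.into f (Circle × Circle) (((1 : Circle), (1 : Circle)) * A v),
        (Rechart.out f (Circle × Circle) w).1 ^ 2), (Rechart.out f (Circle × Circle) w).2)) ∧
    ((((Rechart.out f (Circle × Circle) w).1 : Circle) : ℂ).re ≤ -(3 / 4) →
      e (T₂ (w, v)) = ((Rechart.into f (Circle × Circle) ((((Circle.exp r₀)⁻¹ ^ 2 : Circle), (1 : Circle)) * A v),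
        (Rechart.out f (Circle × Circle) w).1 ^ 2), (Rechart.out f (Circle × Circle) w).2)) := by
  obtain ⟨hp, hn⟩ := BraidedTorus.braidMap_flat (hκ := hκ) (hθ := hθ) (hG := hG) (A := A)
  obtain ⟨h1, h2, -⟩ := circleExp_inv_facts r₀
  constructor
  · intro h
    rw [hT₂, Homeomorph.apply_symm_apply, hp w v h, hx₀]
    simp only [h1]
  · intro h
    rw [hT₂, Homeomorph.apply_symm_apply, hn w v h, hx₀]
    simp only [h2]

include hκ hθ hA hG hx₀ hT₂ hδ hδ1 heQ₂s heQ₂v hP₂s hP₂v hrc hbf in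
/-- **Plumbing coordinates at the resolved point** (`P₂`, flat spot `Re σ ≥ 3/4`). [cite: AkhmedovPark2010, §3] -/
theorem coords_of_re_ge {w : Rechart f (Circle × Circle)}
    (hw : 3 / 4 ≤ (((Rechart.out f (Circle × Circle) w).1 : Circle) : ℂ).re) (v : EuclideanSpace ℝ (Fin 2)) :
    (T₂ (w, v) ∈ P₂.source ↔ 0 < (((((Rechart.out f (Circle × Circle) w).1 ^ 2 : Circle)) : ℂ)).re ∧
        0 < ((((Rechart.out f (Circle × Circle) w).2 : Circle)) : ℂ).re) ∧
      toC2 (P₂ (T₂ (w, v))) = ((c' : ℂ) * rc v, bf w) := by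
  obtain ⟨hflat, -⟩ := flat_forms hκ hθ hG hx₀ hT₂ w v
  have h := ThinArcPlumbing.toC2_plumbing_of_thinArc (xs := ((1 : Circle), (1 : Circle))) hδ hδ1 hA heQ₂s
    heQ₂v hP₂s hP₂v (hflat hw)
  refine ⟨h.1, ?_⟩
  rw [h.2, hrc, hbf, Circle.coe_pow]
  congr 1
  apply Complex.ext <;> simp

include hκ hθ hA hG hx₀ hT₂ hδ hδ1 heQ₃s heQ₃v hP₃s hP₃v hrc hbf in
/-- **Plumbing coordinates at the blown-up point** (`P₃`, flat spot `Re σ ≤ -3/4`). [cite: AkhmedovPark2010, §3] -/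
theorem coords_of_re_le {w : Rechart f (Circle × Circle)}
    (hw : (((Rechart.out f (Circle × Circle) w).1 : Circle) : ℂ).re ≤ -(3 / 4)) (v : EuclideanSpace ℝ (Fin 2)) :
    (T₂ (w, v) ∈ P₃.source ↔ 0 < (((((Rechart.out f (Circle × Circle) w).1 ^ 2 : Circle)) : ℂ)).re ∧
        0 < ((((Rechart.out f (Circle × Circle) w).2 : Circle)) : ℂ).re) ∧
      toC2 (P₃ (T₂ (w, v))) = ((c' : ℂ) * rc v, bf w) := by
  obtain ⟨-, hflat⟩ := flat_forms hκ hθ hG hx₀ hT₂ w v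
  have h := ThinArcPlumbing.toC2_plumbing_of_thinArc (xs := (((Circle.exp r₀)⁻¹ ^ 2 : Circle), (1 : Circle)))
    hδ hδ1 hA heQ₃s heQ₃v hP₃s hP₃v (hflat hw)
  refine ⟨h.1, ?_⟩
  rw [h.2, hrc, hbf, Circle.coe_pow]
  congr 1
  apply Complex.ext <;> simp

include hG hT₂ hP₂s hP₂v hP₃s hP₃v hbf in
/-- **The second plumbing coordinate of any tube point in a plumbing chart** is
`c (Im σ²/Re σ², Im τ/Re τ)`, and `Re σ² > 0`, `Re τ > 0` there (both charts). [cite: AkhmedovPark2010, §3] -/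
theorem snd_coord (w : Rechart f (Circle × Circle)) (v : EuclideanSpace ℝ (Fin 2)) :
    (T₂ (w, v) ∈ P₂.source → (toC2 (P₂ (T₂ (w, v)))).2 = bf w ∧
        0 < (((((Rechart.out f (Circle × Circle) w).1 ^ 2 : Circle)) : ℂ)).re ∧
        0 < ((((Rechart.out f (Circle × Circle) w).2 : Circle)) : ℂ).re) ∧
      (T₂ (w, v) ∈ P₃.source → (toC2 (P₃ (T₂ (w, v)))).2 = bf w ∧
        0 < (((((Rechart.out f (Circle × Circle) w).1 ^ 2 : Circle)) : ℂ)).re ∧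
        0 < ((((Rechart.out f (Circle × Circle) w).2 : Circle)) : ℂ).re) := by
  have hex : e (T₂ (w, v)) = G (w, v) := by rw [hT₂, Homeomorph.apply_symm_apply]
  have hy1 : (e (T₂ (w, v))).1.2 = (Rechart.out f (Circle × Circle) w).1 ^ 2 := by rw [hex, hG]
  have hy2 : (e (T₂ (w, v))).2 = (Rechart.out f (Circle × Circle) w).2 := by rw [hex, hG]
  constructor
  · intro hmem
    rw [hP₂s] at hmem
    obtain ⟨-, h1, h2⟩ := hmem
    rw [hy1] at h1; rw [hy2] at h2
    refine ⟨?_, by rwa [Circle.coe_pow] at h1, h2⟩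
    rw [hP₂v, hbf, hy1, hy2, Circle.coe_pow]
  · intro hmem
    rw [hP₃s] at hmem
    obtain ⟨-, h1, h2⟩ := hmem
    rw [hy1] at h1; rw [hy2] at h2
    refine ⟨?_, by rwa [Circle.coe_pow] at h1, h2⟩
    rw [hP₃v, hbf, hy1, hy2, Circle.coe_pow]

/-- **The thin arc seen from the other plumbing point is far**: for `0 < r₀ ≤ 1/8`,
`0 ≤ δ ≤ r₀/5`, the first factor `z = e^{i δ arctan(t)/2}` of `(1,1) · A v` satisfies, relative to
`ϑ⁻²`: it lies in the quarter region and its quarter coordinate has absolute value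
`≥ tan (2 (2 r₀ - δ π/4))`; the same for `ϑ⁻² z` relative to `1`. [cite: AkhmedovPark2010, §3] -/
theorem thinArc_far_quarter {r₀ δ : ℝ} (hr₀ : 0 < r₀) (hr₀' : r₀ ≤ 1 / 8) (hδ : 0 ≤ δ) (hδr : δ ≤ r₀ / 5)
    (t : ℝ) :
    (0 < (((Circle.exp (δ * Real.arctan t / 2) * ((Circle.exp r₀)⁻¹ ^ 2 : Circle)⁻¹ : Circle) : ℂ)).re ∧
      0 < ((((Circle.exp (δ * Real.arctan t / 2) * ((Circle.exp r₀)⁻¹ ^ 2 : Circle)⁻¹ : Circle) : ℂ)) ^ 2).re ∧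
      Real.tan (2 * (2 * r₀ - δ * (π / 4))) ≤
        |(((Circle.exp (δ * Real.arctan t / 2) * ((Circle.exp r₀)⁻¹ ^ 2 : Circle)⁻¹ : Circle) : ℂ) ^ 2).im /
          (((Circle.exp (δ * Real.arctan t / 2) * ((Circle.exp r₀)⁻¹ ^ 2 : Circle)⁻¹ : Circle) : ℂ) ^ 2).re|) ∧
    (0 < ((((((Circle.exp r₀)⁻¹ ^ 2 : Circle)) * Circle.exp (δ * Real.arctan t / 2) * (1 : Circle)⁻¹ : Circle) : ℂ)).re ∧
      0 < (((((((Circle.exp r₀)⁻¹ ^ 2 : Circle)) * Circle.exp (δ * Real.arctan t / 2) * (1 : Circle)⁻¹ : Circle) : ℂ)) ^ 2).re ∧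
      Real.tan (2 * (2 * r₀ - δ * (π / 4))) ≤
        |((((((Circle.exp r₀)⁻¹ ^ 2 : Circle)) * Circle.exp (δ * Real.arctan t / 2) * (1 : Circle)⁻¹ : Circle) : ℂ) ^ 2).im /
          ((((((Circle.exp r₀)⁻¹ ^ 2 : Circle)) * Circle.exp (δ * Real.arctan t / 2) * (1 : Circle)⁻¹ : Circle) : ℂ) ^ 2).re|) := by
  have hπ := Real.pi_gt_three
  have hπ' := Real.pi_lt_four
  have hε0 : 0 ≤ δ * (π / 4) := by positivity
  have hεα : δ * (π / 4) < |2 * r₀| := by rw [abs_of_pos (by linarith)]; nlinarith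
  have hαε : |2 * r₀| + δ * (π / 4) < π / 4 := by rw [abs_of_pos (by linarith)]; nlinarith
  have hεα' : δ * (π / 4) < |-(2 * r₀)| := by rw [abs_neg]; exact hεα
  have hαε' : |-(2 * r₀)| + δ * (π / 4) < π / 4 := by rw [abs_neg]; exact hαε
  have habs2 : |2 * r₀| = 2 * r₀ := abs_of_pos (by linarith)
  -- `Re z ≥ cos ε` for the thin arc `z = e^{i δ arctan t / 2}`
  have harc : Real.cos (δ * (π / 4)) ≤ ((Circle.exp (δ * Real.arctan t / 2) : Circle) : ℂ).re := by
    have h := QuarterSeparation.re_mul_circleExp_ge_cos (θ := (1 : Circle))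
      (BraidedTorus.abs_mul_arctan_div_two_le hδ t) (by nlinarith : δ * (π / 4) ≤ π)
    rwa [one_mul, inv_one, mul_one] at h
  obtain ⟨-, -, h3⟩ := circleExp_inv_facts r₀
  have hexp2 : Circle.exp (2 * r₀) = Circle.exp r₀ ^ 2 := by rw [sq, ← Circle.exp_add, two_mul]
  constructor
  · -- relative to `ϑ⁻²`, `α = 2 r₀`
    have hz : Real.cos (δ * (π / 4)) ≤ (((Circle.exp (δ * Real.arctan t / 2) *
        ((((Circle.exp r₀)⁻¹ ^ 2 : Circle)) * Circle.exp (2 * r₀))⁻¹ : Circle)) : ℂ).re := by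
      rw [h3, inv_one, mul_one]; exact harc
    have h := QuarterSeparation.re_sq_pos_and_tan_le_abs_quarterCoord hε0 hεα hαε hz
    rw [habs2] at h
    exact h
  · -- relative to `1`, `α = -2 r₀`
    have hθα : ((1 : Circle)) * Circle.exp (-(2 * r₀)) = (Circle.exp r₀)⁻¹ ^ 2 := by
      rw [one_mul, Circle.exp_neg, hexp2, inv_pow]
    have hz : Real.cos (δ * (π / 4)) ≤ ((((((Circle.exp r₀)⁻¹ ^ 2 : Circle)) * Circle.exp (δ * Real.arctan t / 2)) *
        (((1 : Circle)) * Circle.exp (-(2 * r₀)))⁻¹ : Circle) : ℂ).re := by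
      rw [hθα, mul_comm (((Circle.exp r₀)⁻¹ ^ 2 : Circle)) _, mul_assoc, mul_inv_cancel, mul_one]
      exact harc
    have h := QuarterSeparation.re_sq_pos_and_tan_le_abs_quarterCoord hε0 hεα' hαε' hz
    rw [abs_neg, habs2] at h
    exact h

include hκ hθ hA hG hx₀ hT₂ heQ₂v heQ₃v hP₂v hP₃v in
/-- **The two plumbing balls see only their own flat spot**: a tube point over the flat spot
`Re σ ≥ 3/4` that lies in `P₃.source` has `‖P₃ ·‖ ≥ 1`, and a tube point over `Re σ ≤ -3/4` in
`P₂.source` has `‖P₂ ·‖ ≥ 1` (`0 < r₀ ≤ 1/8`, `0 ≤ δ ≤ r₀/5`, `c′ tan (2 (2 r₀ - δ π/4)) ≥ 1`).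
[cite: AkhmedovPark2010, §3] -/
theorem one_le_norm_of_flat (hr₀ : 0 < r₀) (hr₀' : r₀ ≤ 1 / 8) (hδ : 0 ≤ δ) (hδr : δ ≤ r₀ / 5)
    (hc' : 0 < c') (hsep : 1 ≤ c' * Real.tan (2 * (2 * r₀ - δ * (π / 4))))
    (w : Rechart f (Circle × Circle)) (v : EuclideanSpace ℝ (Fin 2)) :
    (3 / 4 ≤ (((Rechart.out f (Circle × Circle) w).1 : Circle) : ℂ).re →
        T₂ (w, v) ∈ P₃.source → 1 ≤ ‖P₃ (T₂ (w, v))‖) ∧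
      ((((Rechart.out f (Circle × Circle) w).1 : Circle) : ℂ).re ≤ -(3 / 4) →
        T₂ (w, v) ∈ P₂.source → 1 ≤ ‖P₂ (T₂ (w, v))‖) := by
  obtain ⟨hflatP, hflatN⟩ := flat_forms hκ hθ hG hx₀ hT₂ w v
  obtain ⟨⟨-, -, hqP⟩, ⟨-, -, hqN⟩⟩ := thinArc_far_quarter hr₀ hr₀' hδ hδr (v 0)
  have hA0 : (A v).1 = Circle.exp (δ * Real.arctan (v 0) / 2) := by rw [hA]
  have key : ∀ {P : OpenPartialHomeomorph X (EuclideanSpace ℝ (Fin 4))} {q : ℝ},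
      (toC2 (P (T₂ (w, v)))).1.re = c' * q → (Real.tan (2 * (2 * r₀ - δ * (π / 4))) ≤ |q|) →
      1 ≤ ‖P (T₂ (w, v))‖ := by
    intro P q hre hq
    have h1 : |c' * q| ≤ ‖P (T₂ (w, v))‖ := by
      rw [← hre]; exact abs_apply_zero_le_norm _
    rw [abs_mul, abs_of_pos hc'] at h1
    calc (1 : ℝ) ≤ c' * Real.tan (2 * (2 * r₀ - δ * (π / 4))) := hsep
      _ ≤ c' * |q| := mul_le_mul_of_nonneg_left hq hc'.le
      _ ≤ ‖P (T₂ (w, v))‖ := h1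
  constructor
  · intro hw _
    have hx : (e (T₂ (w, v))).1.1 = Rechart.into f (Circle × Circle) (((1 : Circle), (1 : Circle)) * A v) := by
      rw [hflatP hw]
    apply key (q := (((Circle.exp (δ * Real.arctan (v 0) / 2) * ((Circle.exp r₀)⁻¹ ^ 2 : Circle)⁻¹ : Circle) : ℂ) ^ 2).im /
          (((Circle.exp (δ * Real.arctan (v 0) / 2) * ((Circle.exp r₀)⁻¹ ^ 2 : Circle)⁻¹ : Circle) : ℂ) ^ 2).re)
    · rw [hP₃v, hx]
      show eQ₃ (Rechart.into f (Circle × Circle) (((1 : Circle), (1 : Circle)) * A v)) 0 = _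
      rw [(heQ₃v _).1, Rechart.out_into, Prod.fst_mul, one_mul, hA0]
    · exact hqP
  · intro hw _
    have hx : (e (T₂ (w, v))).1.1 = Rechart.into f (Circle × Circle)
        ((((Circle.exp r₀)⁻¹ ^ 2 : Circle), (1 : Circle)) * A v) := by
      rw [hflatN hw]
    apply key (q := ((((((Circle.exp r₀)⁻¹ ^ 2 : Circle)) * Circle.exp (δ * Real.arctan (v 0) / 2) * (1 : Circle)⁻¹ : Circle) : ℂ) ^ 2).im /
          ((((((Circle.exp r₀)⁻¹ ^ 2 : Circle)) * Circle.exp (δ * Real.arctan (v 0) / 2) * (1 : Circle)⁻¹ : Circle) : ℂ) ^ 2).re)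
    · rw [hP₂v, hx]
      show eQ₂ (Rechart.into f (Circle × Circle) ((((Circle.exp r₀)⁻¹ ^ 2 : Circle), (1 : Circle)) * A v)) 0 = _
      rw [(heQ₂v _).1, Rechart.out_into, Prod.fst_mul, hA0]
    · exact hqN

include hbf in
/-- **Flatness from the second plumbing coordinate**: `‖bf w‖ < 1`, `Re σ² > 0`, `c ≥ 3` force
`|Re σ| > 3/4`. [cite: AkhmedovPark2010, §3] -/
theorem flat_of_norm_bf_lt (hc : 3 ≤ c) {w : Rechart f (Circle × Circle)}
    (hre : 0 < (((((Rechart.out f (Circle × Circle) w).1 : Circle) : ℂ)) ^ 2).re) (hlt : ‖bf w‖ < 1) :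
    3 / 4 < |((((Rechart.out f (Circle × Circle) w).1 : Circle) : ℂ)).re| := by
  apply flat_of_quarter_lt hc hre
  refine lt_of_le_of_lt ?_ hlt
  have h1 : (bf w).re = c * ((((((Rechart.out f (Circle × Circle) w).1 : Circle) : ℂ)) ^ 2).im /
      (((((Rechart.out f (Circle × Circle) w).1 : Circle) : ℂ)) ^ 2).re) := by rw [hbf]
  have := Complex.abs_re_le_norm (bf w)
  rwa [h1] at this

end Data

end BraidedSheetCoords

end Literature.Topology.FourManifolds
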